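import Summits.Ventures.LatticeQCDFlow.Scoring.UNWilsonLoopSecondMoment2D
import Summits.Ventures.LatticeQCDFlow.Scoring.UNOnePlaquetteSymmetricTwoPoint
import HarnessLib

/-!
# The exact moment `⟨(tr W_{R×T})²⟩_β` of two-dimensional `U(N)` Wilson loops: `d_S·P_S(β)^{RT} + d_A·P_A(β)^{RT}`

HONEST FRAMING: exact (Metropolis-corrected) sampling algorithms for lattice gauge theory;
figures of merit are autocorrelation/cost numbers at stated couplings and volumes; no
continuum-physics claim.

Venture `LatticeQCDFlow` (cell pub-lqcd), sub-topic `Scoring`; FANOUT row 5 (`s0-sun-a`), GEN-21.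
NEW WORK of the cell (placement rule).  Companion of `UNWilsonLoopSecondMoment2D` (`⟨|tr W|²⟩_β = 1 + (N²−1)P_adj^{RT}`,
the `u ⊗ ū` channel): the `u ⊗ u` channel gives the other quadratic moment.  For the free-boundary `R × T` lattice of
two-dimensional `U(N)` lattice Yang–Mills (`N ≥ 2`, every real `β`, weight `e^{−β(N − Re tr U_p)}`, `R + 1 ≤ L`,
`T + 1 ≤ L` in `(ℤ/L)²`):

  **`⟨(tr W_{R×T})²⟩_β = (N(N+1)/2)·((s₁ + s₂)/(N(N+1)·D))^{RT} + (N(N−1)/2)·((s₁ − s₂)/(N(N−1)·D))^{RT}`**,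

`D = det[I_{|i−j|}(β)] = ∫ e^{βRe tr u} du`, `s₁ = ∫ (tr u)² e^{βRe tr u} du`, `s₂ = ∫ tr(u²) e^{βRe tr u} du` — i.e.
`d_S·P_S^{RT} + d_A·P_A^{RT}` with the normalised symmetric-square and exterior-square "plaquettes"
`P_S = ⟨χ_{Sym²}⟩_β/d_S`, `P_A = ⟨χ_{Λ²}⟩_β/d_A` (`χ_{Sym²/Λ²}(u) = ((tr u)² ± tr u²)/2`, `d_{S/A} = N(N±1)/2`).  With
the first moment `⟨tr W⟩ = N·P_N^{RT}` (GEN-18) and `⟨|tr W|²⟩` (GEN-21) this is the exact variance of the measured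
loop `Re tr W_{R×T}`: `Var_β(Re tr W) = ½(⟨|tr W|²⟩ + Re⟨(tr W)²⟩) − ⟨Re tr W⟩²` (sequel).  Route:

* (the powers of the congruence channel `Y ↦ A'·Y + B'·Yᵀ` — `S'ⁿ Y = aₙ·Y + bₙ·Yᵀ`, trace functional
  `(N(N+1)/2)(A'+B')ⁿ + (N(N−1)/2)(A'−B')ⁿ` — are GEN-21's §2 of `AdjointChannelPowers`);
* §1 `unitary_trace_kronecker_integral_pow` — the one-plaquette `u ⊗ₖ u` matrix is the matrix of the congruence
  channel (GEN-21 `UNOnePlaquetteSymmetricTwoPoint`), so `tr Mⁿ = (N(N+1)/2)(A'+B')ⁿ + (N(N−1)/2)(A'−B')ⁿ`;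
* §2 **`unitary_open_trace_sq_wilsonLoop_eq`** — the Kronecker area law (`NonabelianAreaLaw2DWilsonLoop` §5 with
  `ρ = σ` the defining representation) and GEN-18's partition function.

No `def`, nothing cited as a fact, 0 sorry.
-/

noncomputable section

open MeasureTheory Function Finset
open Literature.MathematicalPhysics.QuantumFieldTheory
open Literature.MathematicalPhysics.QuantumLattice
open Summit.Ventures.LatticeQCDFlow.Theory2.Lattice
open Summit.Ventures.LatticeQCDFlow.Theory2.Lattice.TwoDim
open Literature.Analysis.FunctionSpaces (besselI)
open scoped Kronecker Matrix

namespace Summit.Ventures.LatticeQCDFlow.Scoring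



/-! ## §1. The one-plaquette `u ⊗ u` matrix of `U(N)` is the matrix of the congruence channel -/

section OnePlaquette

variable {N : ℕ}

/-- The Kronecker square `u ⊗ₖ u`, entrywise: `(u ⊗ₖ u)_{(a,b),(c,d)} = (u E_{cd} uᵀ)_{ab}`. -/
theorem kronecker_self_apply (U : Matrix (Fin N) (Fin N) ℂ) (k l : Fin N × Fin N) :
    (U ⊗ₖ U) k l = (U * Matrix.single l.1 l.2 (1 : ℂ) * Uᵀ) k.1 k.2 := by
  rw [Matrix.kroneckerMap_apply, congr_single_apply]

/-- **`tr Mⁿ = (N(N+1)/2)(A'+B')ⁿ + (N(N−1)/2)(A'−B')ⁿ`** for the one-plaquette Kronecker-square matrix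
`M_{(a,b),(c,d)} = ∫ (u ⊗ₖ u)_{(a,b),(c,d)} e^{βRe tr u} du` of `U(N)`, `N ≥ 2`, where
`A' + B' = (s₁ + s₂)/(N(N+1))`, `A' − B' = (s₁ − s₂)/(N(N−1))`. -/
theorem unitary_trace_kronecker_integral_pow (hN : 2 ≤ N) (β : ℝ) (n : ℕ) :
    ((Matrix.of fun k l : Fin N × Fin N => ∫ u, (((u : Matrix.unitaryGroup (Fin N) ℂ) : Matrix (Fin N) (Fin N) ℂ) ⊗ₖ
        ((u : Matrix.unitaryGroup (Fin N) ℂ) : Matrix (Fin N) (Fin N) ℂ)) k l *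
        (Real.exp (β * ((u : Matrix.unitaryGroup (Fin N) ℂ) : Matrix (Fin N) (Fin N) ℂ).trace.re) : ℂ)
        ∂(haarProbability (Matrix.unitaryGroup (Fin N) ℂ))) ^ n).trace =
      ((N : ℂ) * (N + 1) / 2) *
          (((∫ u, ((u : Matrix.unitaryGroup (Fin N) ℂ) : Matrix (Fin N) (Fin N) ℂ).trace ^ 2 *
              (Real.exp (β * ((u : Matrix.unitaryGroup (Fin N) ℂ) : Matrix (Fin N) (Fin N) ℂ).trace.re) : ℂ)
              ∂(haarProbability (Matrix.unitaryGroup (Fin N) ℂ))) +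
            (∫ u, (((u : Matrix.unitaryGroup (Fin N) ℂ) : Matrix (Fin N) (Fin N) ℂ) *
              ((u : Matrix.unitaryGroup (Fin N) ℂ) : Matrix (Fin N) (Fin N) ℂ)).trace *
              (Real.exp (β * ((u : Matrix.unitaryGroup (Fin N) ℂ) : Matrix (Fin N) (Fin N) ℂ).trace.re) : ℂ)
              ∂(haarProbability (Matrix.unitaryGroup (Fin N) ℂ)))) / (N * (N + 1))) ^ n +
        ((N : ℂ) * (N - 1) / 2) *
          (((∫ u, ((u : Matrix.unitaryGroup (Fin N) ℂ) : Matrix (Fin N) (Fin N) ℂ).trace ^ 2 *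
              (Real.exp (β * ((u : Matrix.unitaryGroup (Fin N) ℂ) : Matrix (Fin N) (Fin N) ℂ).trace.re) : ℂ)
              ∂(haarProbability (Matrix.unitaryGroup (Fin N) ℂ))) -
            (∫ u, (((u : Matrix.unitaryGroup (Fin N) ℂ) : Matrix (Fin N) (Fin N) ℂ) *
              ((u : Matrix.unitaryGroup (Fin N) ℂ) : Matrix (Fin N) (Fin N) ℂ)).trace *
              (Real.exp (β * ((u : Matrix.unitaryGroup (Fin N) ℂ) : Matrix (Fin N) (Fin N) ℂ).trace.re) : ℂ)
              ∂(haarProbability (Matrix.unitaryGroup (Fin N) ℂ)))) / (N * (N - 1))) ^ n := by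
  haveI : NeZero N := ⟨by omega⟩
  set s₁ : ℂ := ∫ u, ((u : Matrix.unitaryGroup (Fin N) ℂ) : Matrix (Fin N) (Fin N) ℂ).trace ^ 2 *
    (Real.exp (β * ((u : Matrix.unitaryGroup (Fin N) ℂ) : Matrix (Fin N) (Fin N) ℂ).trace.re) : ℂ)
    ∂(haarProbability (Matrix.unitaryGroup (Fin N) ℂ)) with hs₁
  set s₂ : ℂ := ∫ u, (((u : Matrix.unitaryGroup (Fin N) ℂ) : Matrix (Fin N) (Fin N) ℂ) *
    ((u : Matrix.unitaryGroup (Fin N) ℂ) : Matrix (Fin N) (Fin N) ℂ)).trace *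
    (Real.exp (β * ((u : Matrix.unitaryGroup (Fin N) ℂ) : Matrix (Fin N) (Fin N) ℂ).trace.re) : ℂ)
    ∂(haarProbability (Matrix.unitaryGroup (Fin N) ℂ)) with hs₂
  set A : ℂ := (N * s₁ - s₂) / (N * ((N : ℂ) ^ 2 - 1)) with hA
  set B : ℂ := (N * s₂ - s₁) / (N * ((N : ℂ) ^ 2 - 1)) with hB
  set τ : Matrix (Fin N) (Fin N) ℂ →ₗ[ℂ] Matrix (Fin N) (Fin N) ℂ :=
    { toFun := fun Y => Yᵀ
      map_add' := fun Y Z => Matrix.transpose_add Y Z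
      map_smul' := fun c Y => Matrix.transpose_smul c Y } with hτ
  have hτa : ∀ Y, τ Y = Yᵀ := fun Y => rfl
  have hS : ∀ k l : Fin N × Fin N, (∫ u, (((u : Matrix.unitaryGroup (Fin N) ℂ) : Matrix (Fin N) (Fin N) ℂ) ⊗ₖ
        ((u : Matrix.unitaryGroup (Fin N) ℂ) : Matrix (Fin N) (Fin N) ℂ)) k l *
        (Real.exp (β * ((u : Matrix.unitaryGroup (Fin N) ℂ) : Matrix (Fin N) (Fin N) ℂ).trace.re) : ℂ)
        ∂(haarProbability (Matrix.unitaryGroup (Fin N) ℂ))) =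
      ((A • LinearMap.id + B • τ : Module.End ℂ (Matrix (Fin N) (Fin N) ℂ)) (Matrix.single l.1 l.2 1)) k.1 k.2 := by
    intro k l
    simp_rw [kronecker_self_apply]
    rw [integral_unitary_congr_entry_mul_exp hN β (Matrix.single l.1 l.2 1) k.1 k.2, ← hs₁, ← hs₂]
    simp only [hA, hB, LinearMap.add_apply, LinearMap.smul_apply, LinearMap.id_apply, hτa, Matrix.add_apply,
      Matrix.smul_apply, smul_eq_mul, Matrix.transpose_apply]
  rw [trace_pow_eq_sum_channel_pow_single _ _ (fun k l => by rw [Matrix.of_apply]; exact hS k l) n]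
  simp_rw [congrChannel_linearMap_pow_apply A B τ hτa, sum_congrChannel_iterate_single]
  have hN0 : (N : ℂ) ≠ 0 := Nat.cast_ne_zero.2 (NeZero.ne N)
  have hN1 : ((N : ℂ) + 1) ≠ 0 := by
    have : ((N : ℝ) + 1) ≠ 0 := by positivity
    exact_mod_cast this
  have hN1' : ((N : ℂ) - 1) ≠ 0 := by
    have h2 : (2 : ℝ) ≤ N := by exact_mod_cast hN
    have : ((N : ℝ) - 1) ≠ 0 := by linarith
    exact_mod_cast this
  have hN2 : ((N : ℂ) ^ 2 - 1) ≠ 0 := by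
    have h : ((N : ℂ) ^ 2 - 1) = (N + 1) * (N - 1) := by ring
    rw [h]; exact mul_ne_zero hN1 hN1'
  have hApB : A + B = (s₁ + s₂) / (N * (N + 1)) := by
    rw [hA, hB]; field_simp; ring
  have hAmB : A - B = (s₁ - s₂) / (N * (N - 1)) := by
    rw [hA, hB]; field_simp; ring
  rw [hApB, hAmB]

end OnePlaquette

/-! ## §2. The moment `⟨(tr W_{R×T})²⟩_β` of the free-boundary `U(N)` Wilson loop -/

section WilsonLoop

variable {L : ℕ} [NeZero L] {N : ℕ}

/-- **THE UNNORMALISED MOMENT**: `∫ (tr W_{R×T})² ∏_p e^{−β(N − Re tr U_p)} dHaar^{⊗E} =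
e^{−NβRT}·((N(N+1)/2)(A'+B')^{RT} + (N(N−1)/2)(A'−B')^{RT})` (`N ≥ 2`). -/
theorem unitary_open_trace_sq_wilsonLoop_integral_eq (hN : 2 ≤ N) (β : ℝ) (i j : ZMod L) {R T : ℕ}
    (hR : R + 1 ≤ L) (hT : T + 1 ≤ L) :
    ∫ U, ((rectangleHolonomy U ![i, j] 0 1 R T : Matrix.unitaryGroup (Fin N) ℂ) : Matrix (Fin N) (Fin N) ℂ).trace ^ 2 *
        ∏ p ∈ (range R ×ˢ range T).image (fun q : ℕ × ℕ => (![i + q.1, j + q.2] : Site 2 L)),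
          (Real.exp (-(β * ((N : ℝ) - ((plaquetteHolonomy U p 0 1 : Matrix.unitaryGroup (Fin N) ℂ) :
            Matrix (Fin N) (Fin N) ℂ).trace.re))) : ℂ)
        ∂(Measure.pi fun _ : Edge 2 L => haarProbability (Matrix.unitaryGroup (Fin N) ℂ)) =
      (Real.exp (-(N * β)) : ℂ) ^ (R * T) *
        (((N : ℂ) * (N + 1) / 2) *
          (((∫ u, ((u : Matrix.unitaryGroup (Fin N) ℂ) : Matrix (Fin N) (Fin N) ℂ).trace ^ 2 *
              (Real.exp (β * ((u : Matrix.unitaryGroup (Fin N) ℂ) : Matrix (Fin N) (Fin N) ℂ).trace.re) : ℂ)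
              ∂(haarProbability (Matrix.unitaryGroup (Fin N) ℂ))) +
            (∫ u, (((u : Matrix.unitaryGroup (Fin N) ℂ) : Matrix (Fin N) (Fin N) ℂ) *
              ((u : Matrix.unitaryGroup (Fin N) ℂ) : Matrix (Fin N) (Fin N) ℂ)).trace *
              (Real.exp (β * ((u : Matrix.unitaryGroup (Fin N) ℂ) : Matrix (Fin N) (Fin N) ℂ).trace.re) : ℂ)
              ∂(haarProbability (Matrix.unitaryGroup (Fin N) ℂ)))) / (N * (N + 1))) ^ (R * T) +
        ((N : ℂ) * (N - 1) / 2) *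
          (((∫ u, ((u : Matrix.unitaryGroup (Fin N) ℂ) : Matrix (Fin N) (Fin N) ℂ).trace ^ 2 *
              (Real.exp (β * ((u : Matrix.unitaryGroup (Fin N) ℂ) : Matrix (Fin N) (Fin N) ℂ).trace.re) : ℂ)
              ∂(haarProbability (Matrix.unitaryGroup (Fin N) ℂ))) -
            (∫ u, (((u : Matrix.unitaryGroup (Fin N) ℂ) : Matrix (Fin N) (Fin N) ℂ) *
              ((u : Matrix.unitaryGroup (Fin N) ℂ) : Matrix (Fin N) (Fin N) ℂ)).trace *
              (Real.exp (β * ((u : Matrix.unitaryGroup (Fin N) ℂ) : Matrix (Fin N) (Fin N) ℂ).trace.re) : ℂ)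
              ∂(haarProbability (Matrix.unitaryGroup (Fin N) ℂ)))) / (N * (N - 1))) ^ (R * T)) := by
  have hw : Continuous fun u : Matrix.unitaryGroup (Fin N) ℂ =>
      Real.exp (-(β * ((N : ℝ) - ((u : Matrix.unitaryGroup (Fin N) ℂ) : Matrix (Fin N) (Fin N) ℂ).trace.re))) := by
    fun_prop
  have h := integral_trace_mul_trace_rectangleHolonomy_mul_prod_weight (unitaryFundamentalRep (Fin N) ℂ)
    (unitaryFundamentalRep (Fin N) ℂ) (continuous_unitaryFundamentalRep (Fin N) ℂ)
    (continuous_unitaryFundamentalRep (Fin N) ℂ) hw (unitary_wilsonWeight_conj N β) i j hT hR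
  simp only [unitaryFundamentalRep_apply, ← sq] at h
  rw [h]
  have hsplit : ∀ u : Matrix.unitaryGroup (Fin N) ℂ,
      (Real.exp (-(β * ((N : ℝ) - ((u : Matrix.unitaryGroup (Fin N) ℂ) : Matrix (Fin N) (Fin N) ℂ).trace.re))) : ℂ) =
        (Real.exp (-(N * β)) : ℂ) *
          (Real.exp (β * ((u : Matrix.unitaryGroup (Fin N) ℂ) : Matrix (Fin N) (Fin N) ℂ).trace.re) : ℂ) := by
    intro u; rw [← Complex.ofReal_mul, ← Real.exp_add]; congr 2; ring
  have hM : (Matrix.of fun k l : Fin N × Fin N => ∫ g, (((g : Matrix.unitaryGroup (Fin N) ℂ) : Matrix (Fin N) (Fin N) ℂ) ⊗ₖ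
      ((g : Matrix.unitaryGroup (Fin N) ℂ) : Matrix (Fin N) (Fin N) ℂ)) k l *
        (Real.exp (-(β * ((N : ℝ) - ((g : Matrix.unitaryGroup (Fin N) ℂ) : Matrix (Fin N) (Fin N) ℂ).trace.re))) : ℂ)
        ∂(haarProbability (Matrix.unitaryGroup (Fin N) ℂ))) =
      (Real.exp (-(N * β)) : ℂ) • (Matrix.of fun k l : Fin N × Fin N => ∫ u,
        (((u : Matrix.unitaryGroup (Fin N) ℂ) : Matrix (Fin N) (Fin N) ℂ) ⊗ₖ
          ((u : Matrix.unitaryGroup (Fin N) ℂ) : Matrix (Fin N) (Fin N) ℂ)) k l *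
        (Real.exp (β * ((u : Matrix.unitaryGroup (Fin N) ℂ) : Matrix (Fin N) (Fin N) ℂ).trace.re) : ℂ)
        ∂(haarProbability (Matrix.unitaryGroup (Fin N) ℂ))) := by
    ext k l
    simp only [Matrix.of_apply, Matrix.smul_apply, smul_eq_mul, hsplit]
    rw [← integral_const_mul]
    exact integral_congr_ae (ae_of_all _ fun u => by ring)
  rw [hM, smul_pow, Matrix.trace_smul, smul_eq_mul, unitary_trace_kronecker_integral_pow hN β (R * T)]

/-- **THE EXACT MOMENT `⟨(tr W_{R×T})²⟩_β` OF TWO-DIMENSIONAL `U(N)` WILSON LOOPS WITH FREE BOUNDARY** (`N ≥ 2`,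
every real `β`, `R + 1 ≤ L`, `T + 1 ≤ L`): with `D = det[I_{|i−j|}(β)]`, `s₁ = ∫ (tr u)² e^{βRe tr u} du`,
`s₂ = ∫ tr(u²) e^{βRe tr u} du`,
`∫ (tr W)² ∏_p e^{−β(N−Re tr U_p)} / ∫ ∏_p e^{−β(N−Re tr U_p)} =
(N(N+1)/2)·((s₁ + s₂)/(N(N+1)D))^{RT} + (N(N−1)/2)·((s₁ − s₂)/(N(N−1)D))^{RT}` — dimension times the `RT`-th power
of the normalised one-plaquette expectation, for each of the two irreducible pieces `Sym²`, `Λ²` of `u ⊗ u`. -/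
theorem unitary_open_trace_sq_wilsonLoop_eq (hN : 2 ≤ N) (β : ℝ) (i j : ZMod L) {R T : ℕ}
    (hR : R + 1 ≤ L) (hT : T + 1 ≤ L) :
    (∫ U, ((rectangleHolonomy U ![i, j] 0 1 R T : Matrix.unitaryGroup (Fin N) ℂ) : Matrix (Fin N) (Fin N) ℂ).trace ^ 2 *
        ∏ p ∈ (range R ×ˢ range T).image (fun q : ℕ × ℕ => (![i + q.1, j + q.2] : Site 2 L)),
          (Real.exp (-(β * ((N : ℝ) - ((plaquetteHolonomy U p 0 1 : Matrix.unitaryGroup (Fin N) ℂ) :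
            Matrix (Fin N) (Fin N) ℂ).trace.re))) : ℂ)
        ∂(Measure.pi fun _ : Edge 2 L => haarProbability (Matrix.unitaryGroup (Fin N) ℂ))) /
      ((∫ U, ∏ p ∈ (range R ×ˢ range T).image (fun q : ℕ × ℕ => (![i + q.1, j + q.2] : Site 2 L)),
          Real.exp (-(β * ((N : ℝ) - ((plaquetteHolonomy U p 0 1 : Matrix.unitaryGroup (Fin N) ℂ) :
            Matrix (Fin N) (Fin N) ℂ).trace.re)))
        ∂(Measure.pi fun _ : Edge 2 L => haarProbability (Matrix.unitaryGroup (Fin N) ℂ)) : ℝ) : ℂ) =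
      ((N : ℂ) * (N + 1) / 2) *
          (((∫ u, ((u : Matrix.unitaryGroup (Fin N) ℂ) : Matrix (Fin N) (Fin N) ℂ).trace ^ 2 *
              (Real.exp (β * ((u : Matrix.unitaryGroup (Fin N) ℂ) : Matrix (Fin N) (Fin N) ℂ).trace.re) : ℂ)
              ∂(haarProbability (Matrix.unitaryGroup (Fin N) ℂ))) +
            (∫ u, (((u : Matrix.unitaryGroup (Fin N) ℂ) : Matrix (Fin N) (Fin N) ℂ) *
              ((u : Matrix.unitaryGroup (Fin N) ℂ) : Matrix (Fin N) (Fin N) ℂ)).trace *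
              (Real.exp (β * ((u : Matrix.unitaryGroup (Fin N) ℂ) : Matrix (Fin N) (Fin N) ℂ).trace.re) : ℂ)
              ∂(haarProbability (Matrix.unitaryGroup (Fin N) ℂ)))) /
            (N * (N + 1) * (((Matrix.of fun i j : Fin N => besselI ((i : ℤ) - (j : ℤ)).natAbs β).det : ℝ) : ℂ))) ^ (R * T) +
        ((N : ℂ) * (N - 1) / 2) *
          (((∫ u, ((u : Matrix.unitaryGroup (Fin N) ℂ) : Matrix (Fin N) (Fin N) ℂ).trace ^ 2 *
              (Real.exp (β * ((u : Matrix.unitaryGroup (Fin N) ℂ) : Matrix (Fin N) (Fin N) ℂ).trace.re) : ℂ)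
              ∂(haarProbability (Matrix.unitaryGroup (Fin N) ℂ))) -
            (∫ u, (((u : Matrix.unitaryGroup (Fin N) ℂ) : Matrix (Fin N) (Fin N) ℂ) *
              ((u : Matrix.unitaryGroup (Fin N) ℂ) : Matrix (Fin N) (Fin N) ℂ)).trace *
              (Real.exp (β * ((u : Matrix.unitaryGroup (Fin N) ℂ) : Matrix (Fin N) (Fin N) ℂ).trace.re) : ℂ)
              ∂(haarProbability (Matrix.unitaryGroup (Fin N) ℂ)))) /
            (N * (N - 1) * (((Matrix.of fun i j : Fin N => besselI ((i : ℤ) - (j : ℤ)).natAbs β).det : ℝ) : ℂ))) ^ (R * T) := by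
  set s₁ : ℂ := ∫ u, ((u : Matrix.unitaryGroup (Fin N) ℂ) : Matrix (Fin N) (Fin N) ℂ).trace ^ 2 *
    (Real.exp (β * ((u : Matrix.unitaryGroup (Fin N) ℂ) : Matrix (Fin N) (Fin N) ℂ).trace.re) : ℂ)
    ∂(haarProbability (Matrix.unitaryGroup (Fin N) ℂ)) with hs₁
  set s₂ : ℂ := ∫ u, (((u : Matrix.unitaryGroup (Fin N) ℂ) : Matrix (Fin N) (Fin N) ℂ) *
    ((u : Matrix.unitaryGroup (Fin N) ℂ) : Matrix (Fin N) (Fin N) ℂ)).trace *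
    (Real.exp (β * ((u : Matrix.unitaryGroup (Fin N) ℂ) : Matrix (Fin N) (Fin N) ℂ).trace.re) : ℂ)
    ∂(haarProbability (Matrix.unitaryGroup (Fin N) ℂ)) with hs₂
  set D : ℝ := (Matrix.of fun i j : Fin N => besselI ((i : ℤ) - (j : ℤ)).natAbs β).det with hD
  have hDpos : 0 < D := det_besselI_toeplitz_fin_pos N β
  have hD0 : (D : ℂ) ≠ 0 := by exact_mod_cast hDpos.ne'
  have hE0 : (Real.exp (-(N * β)) : ℂ) ≠ 0 := by exact_mod_cast (Real.exp_pos _).ne'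
  rw [unitary_open_partitionFunction_eq N β i j hR hT, unitary_open_trace_sq_wilsonLoop_integral_eq (L := L) hN β i j hR hT,
    ← hs₁, ← hs₂, ← hD, Complex.ofReal_pow, Complex.ofReal_mul, mul_pow, mul_div_mul_left _ _ (pow_ne_zero _ hE0)]
  have key : ∀ c x : ℂ, c * x ^ (R * T) / (D : ℂ) ^ (R * T) = c * (x / D) ^ (R * T) := by
    intro c x; rw [div_pow, mul_div_assoc]
  rw [add_div, key, key, div_div, div_div]


/-- `∫_{U(N)} tr(U²) dU = 0` (every `N`): left invariance under the central `i·1`, whose square is `−1`. -/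
theorem un_integral_trace_mul_self_eq_zero :
    ∫ u, (((u : Matrix.unitaryGroup (Fin N) ℂ) : Matrix (Fin N) (Fin N) ℂ) *
        ((u : Matrix.unitaryGroup (Fin N) ℂ) : Matrix (Fin N) (Fin N) ℂ)).trace
      ∂(haarProbability (Matrix.unitaryGroup (Fin N) ℂ)) = 0 := by
  set μ := haarProbability (Matrix.unitaryGroup (Fin N) ℂ) with hμ
  have key := integral_mul_left_eq_self (μ := μ)
    (fun U : Matrix.unitaryGroup (Fin N) ℂ => (((U : Matrix.unitaryGroup (Fin N) ℂ) : Matrix (Fin N) (Fin N) ℂ) *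
      ((U : Matrix.unitaryGroup (Fin N) ℂ) : Matrix (Fin N) (Fin N) ℂ)).trace)
    ⟨(Complex.I : ℂ) • 1, Summit.Ventures.LatticeQCDFlow.TrivializingMaps.I_smul_one_mem_unitaryGroup⟩
  have e : ∀ U : Matrix.unitaryGroup (Fin N) ℂ,
      ((((⟨(Complex.I : ℂ) • 1, Summit.Ventures.LatticeQCDFlow.TrivializingMaps.I_smul_one_mem_unitaryGroup⟩ * U :
        Matrix.unitaryGroup (Fin N) ℂ) : Matrix.unitaryGroup (Fin N) ℂ) : Matrix (Fin N) (Fin N) ℂ) *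
        (((⟨(Complex.I : ℂ) • 1, Summit.Ventures.LatticeQCDFlow.TrivializingMaps.I_smul_one_mem_unitaryGroup⟩ * U :
        Matrix.unitaryGroup (Fin N) ℂ) : Matrix.unitaryGroup (Fin N) ℂ) : Matrix (Fin N) (Fin N) ℂ)).trace
        = -((((U : Matrix.unitaryGroup (Fin N) ℂ) : Matrix (Fin N) (Fin N) ℂ) *
          ((U : Matrix.unitaryGroup (Fin N) ℂ) : Matrix (Fin N) (Fin N) ℂ)).trace) := by
    intro U
    show ((((Complex.I : ℂ) • (1 : Matrix (Fin N) (Fin N) ℂ)) * (U : Matrix (Fin N) (Fin N) ℂ)) *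
      (((Complex.I : ℂ) • (1 : Matrix (Fin N) (Fin N) ℂ)) * (U : Matrix (Fin N) (Fin N) ℂ))).trace = _
    rw [Matrix.smul_mul, one_mul, Matrix.smul_mul, Matrix.mul_smul, smul_smul, Complex.I_mul_I, Matrix.trace_smul,
      smul_eq_mul, neg_one_mul]
  simp only [e] at key
  rw [integral_neg] at key
  linear_combination (-(1 : ℂ) / 2) * key

/-- **Sanity at `β = 0`** (pure Haar links, `N ≥ 2`, `RT ≥ 1`): `⟨(tr W_{R×T})²⟩₀ = 0` — `s₁(0) = ∫(tr u)² du = 0` and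
`s₂(0) = ∫tr(u²) du = 0` (charge `2` under the centre), so `P_S(0) = P_A(0) = 0`. -/
theorem unitary_open_trace_sq_wilsonLoop_eq_zero (hN : 2 ≤ N) (i j : ZMod L) {R T : ℕ}
    (hR : R + 1 ≤ L) (hT : T + 1 ≤ L) (hRT : 0 < R * T) :
    (∫ U, ((rectangleHolonomy U ![i, j] 0 1 R T : Matrix.unitaryGroup (Fin N) ℂ) : Matrix (Fin N) (Fin N) ℂ).trace ^ 2 *
        ∏ p ∈ (range R ×ˢ range T).image (fun q : ℕ × ℕ => (![i + q.1, j + q.2] : Site 2 L)),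
          (Real.exp (-((0 : ℝ) * ((N : ℝ) - ((plaquetteHolonomy U p 0 1 : Matrix.unitaryGroup (Fin N) ℂ) :
            Matrix (Fin N) (Fin N) ℂ).trace.re))) : ℂ)
        ∂(Measure.pi fun _ : Edge 2 L => haarProbability (Matrix.unitaryGroup (Fin N) ℂ))) /
      ((∫ U, ∏ p ∈ (range R ×ˢ range T).image (fun q : ℕ × ℕ => (![i + q.1, j + q.2] : Site 2 L)),
          Real.exp (-((0 : ℝ) * ((N : ℝ) - ((plaquetteHolonomy U p 0 1 : Matrix.unitaryGroup (Fin N) ℂ) :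
            Matrix (Fin N) (Fin N) ℂ).trace.re)))
        ∂(Measure.pi fun _ : Edge 2 L => haarProbability (Matrix.unitaryGroup (Fin N) ℂ)) : ℝ) : ℂ) = 0 := by
  rw [unitary_open_trace_sq_wilsonLoop_eq (L := L) hN 0 i j hR hT]
  have h1 : ∫ u, ((u : Matrix.unitaryGroup (Fin N) ℂ) : Matrix (Fin N) (Fin N) ℂ).trace ^ 2 *
      (Real.exp (0 * ((u : Matrix.unitaryGroup (Fin N) ℂ) : Matrix (Fin N) (Fin N) ℂ).trace.re) : ℂ)
      ∂(haarProbability (Matrix.unitaryGroup (Fin N) ℂ)) = 0 := by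
    simp_rw [zero_mul, Real.exp_zero, Complex.ofReal_one, mul_one]
    exact Summit.Ventures.LatticeQCDFlow.TrivializingMaps.un_integral_trace_sq_eq_zero
  have h2 : ∫ u, (((u : Matrix.unitaryGroup (Fin N) ℂ) : Matrix (Fin N) (Fin N) ℂ) *
      ((u : Matrix.unitaryGroup (Fin N) ℂ) : Matrix (Fin N) (Fin N) ℂ)).trace *
      (Real.exp (0 * ((u : Matrix.unitaryGroup (Fin N) ℂ) : Matrix (Fin N) (Fin N) ℂ).trace.re) : ℂ)
      ∂(haarProbability (Matrix.unitaryGroup (Fin N) ℂ)) = 0 := by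
    simp_rw [zero_mul, Real.exp_zero, Complex.ofReal_one, mul_one]
    exact un_integral_trace_mul_self_eq_zero
  rw [h1, h2, add_zero, sub_zero, zero_div, zero_div, zero_pow hRT.ne', mul_zero, mul_zero, add_zero]

end WilsonLoop

end Summit.Ventures.LatticeQCDFlow.Scoring
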